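import Literature.Computability.AlgebraicComplexity.BI17Ex56KroneckerSevenFive
import Literature.Computability.AlgebraicComplexity.KronRectSevenSix
import Literature.Computability.AlgebraicComplexity.BI17KronRectPiece30
import HarnessLib

/-!
# Bürgisser–Ikenmeyer 2017, Ex. 5.6: the shape clause at `m = 7` — `E(7) = {0} ∪ (28 + 7ℕ)` — PROVED

P. Bürgisser, C. Ikenmeyer, *Fundamental invariants of orbit closures*, J. Algebra **477** (2017)
390–434 = arXiv:1511.02927 [BurgisserIkenmeyer2017], Ex. 5.6 (held text `paper:arxiv-1511.02927`
p0018): "But we have `E'(7) = {0,4,5,6,7,8,…}` generated by `4,5,6,7`, with the gaps `1,2,3`" (in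
print a computation with the DERKSEN program). THEOREM-ONLY leaf (no definition, no named fact)
closing the `m = 7` instance of the shape clause
`∀ m, 3 ≤ m → m ≤ 12 → E(m) = {d | d = 0 ∨ ∃ δ, d = mδ ∧ e(m) ≤ mδ}` of the named fact `BI2017_ex_5_6`
(`BI17FundamentalInvariantTensors.lean`, val-lit row BI2017-B) — the first instance beyond `m ≤ 6`
(`BI2017_ex_5_6_shape_of_le_six`, `BI17Ex56SmallCases.lean`):

* `BI2017_ex_5_6_shape_seven_holds` — from `BI2017_ex_5_6_shape_seven_of_six`
  (`BI17Ex56KroneckerSevenFive.lean`: `k_7(4) = 14`, `k_7(5) = 1456` by the chunked `S_35` class sum,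
  `k_7(7) > 0` by square positivity, `k_7(3) = 0`) and the last atom `k_7(6) > 0`
  (`kronRect_seven_six_pos`, `KronRectSevenSix.lean`, val-lit t03 g7: ONE block-sign design
  certificate — seven affine lines of `ℤ₆³` — through the engine `KronRectDesignCertificates.lean`);
* `fortyTwo_mem_genericTensorDegreeMonoid_seven : 42 ∈ E(7)`;
* `BI2017_ex_5_6_of_eight_atoms` — the named fact from its EIGHT remaining atoms
  `k_8(5), k_9(5), k_10(7), k_11(5), k_11(6), k_11(7), k_12(5), k_12(7) > 0` (via
  `BI2017_ex_5_6_of_coprime_atoms`, `BI17KronRectPiece30.lean`, val-lit t10 g7, with `h7_5`, `h7_6`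
  discharged). The fact itself stays OPEN: every other clause `m ∈ {8, …, 12}` needs an odd-`δ` atom,
  for which only class sums in `S_40 … S_84` are known roads (AY22 Table 4 prints `k_8(5) = 9854`).

Honest framing: typed-literature bookkeeping for the cell `val-lit` (LADDER-VALIANT V3, a
known-results layer); nothing here bears on VP versus VNP.

## References
* [BurgisserIkenmeyer2017] Ex. 5.6, §5 eq. (5.2).
* [AmanovYeliussizov2022] A. Amanov, D. Yeliussizov, IMRN 2023 = arXiv:2202.11059, Table 1
  (`δ_3(7)/7 = 4`), Table 4 (`k_7(5) = 1456`, `k_7(6) = 438744`), Thm. 8.4.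

Provenance: val-lit cell, literature-prover val-lit-t08 g6 (programme #8-lite; inputs by t03 g7,
t04 g6, t10 g7, t12 g8, p4 g6).
-/

namespace Literature.Computability.AlgebraicComplexity

/-- **BI 2017, Ex. 5.6, shape clause at `m = 7` (PROVED): `E(7) = {0} ∪ (28 + 7ℕ)`**, i.e.
"`E'(7) = {0,4,5,6,7,8,…}`" — the `m = 7` instance of `BI2017_ex_5_6`'s clause
`E(m) = {d | d = 0 ∨ ∃ δ, d = mδ ∧ e(m) ≤ mδ}`, from the atoms `k_7(4) = 14`, `k_7(5) = 1456` (`S_35`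
class sum), `k_7(6) > 0` (design certificate), `k_7(7) > 0` and `k_7(1) = k_7(2) = k_7(3) = 0`.
[cite: BurgisserIkenmeyer2017, Ex. 5.6] -/
theorem BI2017_ex_5_6_shape_seven_holds :
    genericTensorDegreeMonoid (Fin 7) ℂ =
      {d | d = 0 ∨ ∃ δ : ℕ, d = 7 * δ ∧ genericTensorMinimalDegree (Fin 7) ℂ ≤ 7 * δ} :=
  BI2017_ex_5_6_shape_seven_of_six (kronRect_seven_six_pos ℂ)

/-- `42 ∈ E(7)`: generic `7 × 7 × 7` tensors have a nonzero `SL_7³`-invariant of degree `42`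
(`k_7(6) > 0`). [cite: BurgisserIkenmeyer2017, Ex. 5.6] -/
theorem fortyTwo_mem_genericTensorDegreeMonoid_seven : 42 ∈ genericTensorDegreeMonoid (Fin 7) ℂ := by
  rw [genericTensorDegreeMonoid_eq_kronRect 7]
  exact ⟨6, rfl, kronRect_seven_six_pos ℂ⟩

/-- `k_7(δ) > 0` for every `δ ≥ 4` ("`E'(7) = {0,4,5,6,7,8,…}` generated by `4,5,6,7`").
[cite: BurgisserIkenmeyer2017, Ex. 5.6] -/
theorem kronRect_seven_pos_of_four_le {δ : ℕ} (hδ : 4 ≤ δ) : 0 < kronRect ℂ 7 δ := by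
  refine kronRect_pos_of_window (m := 7) (δ₀ := 4) (by norm_num) (by norm_num) (fun δ h1 h2 => ?_) δ hδ
  interval_cases δ
  · exact kronRect_seven_four_pos
  · exact kronRect_seven_five_pos
  · exact kronRect_seven_six_pos ℂ
  · exact kronRect_self_pos 7 (by norm_num)

/-- **`BI2017_ex_5_6` from its EIGHT remaining atoms** `k_8(5), k_9(5), k_10(7), k_11(5), k_11(6),
k_11(7), k_12(5), k_12(7) > 0` (Ex. 5.6's DERKSEN values; `h7_5`, `h7_6` of
`BI2017_ex_5_6_of_coprime_atoms` are now the theorems `kronRect_seven_five_pos`,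
`kronRect_seven_six_pos`). [cite: BurgisserIkenmeyer2017, Ex. 5.6 and Rem. 5.18] -/
theorem BI2017_ex_5_6_of_eight_atoms
    (h8_5 : 0 < kronRect ℂ 8 5) (h9_5 : 0 < kronRect ℂ 9 5) (h10_7 : 0 < kronRect ℂ 10 7)
    (h11_5 : 0 < kronRect ℂ 11 5) (h11_6 : 0 < kronRect ℂ 11 6) (h11_7 : 0 < kronRect ℂ 11 7)
    (h12_5 : 0 < kronRect ℂ 12 5) (h12_7 : 0 < kronRect ℂ 12 7) :
    BI2017_ex_5_6 :=
  BI2017_ex_5_6_of_coprime_atoms kronRect_seven_five_pos (kronRect_seven_six_pos ℂ) h8_5 h9_5 h10_7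
    h11_5 h11_6 h11_7 h12_5 h12_7

end Literature.Computability.AlgebraicComplexity
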